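import Literature.Claims.NS.ClayR3BKMBridge
import Literature.Claims.NS.AlZawahreh2026
import HarnessLib

/-!
# Claim skeleton C145 — Magsanop, «Global Regularity for the 3D Navier-Stokes Equations via Energy
# Decay and BKM Criterion and 4D Viscous Extension» (Zenodo 20719707, «Version 4.0», 2026-06-16)

**Cite header.** Marvin Magsanop (as printed p.1; record creator «magsanop, marvin»), *Global Regularity
for the 3D Navier-Stokes Equations via Energy Decay and BKM Criterion and 4D Viscous Extension*, Zenodo
record 20719707 (concept 10.5281/zenodo.20656331), file `NSE_V4_MAGSANOP_2026.pdf` (sha256[:16]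
5d37e34c3af0f5dd, 5 pp., «Version 4.0», PDF page = page; no running page numbers; `l.N` = line of the
census pin text layer `census/texts/Magsanop2026/pages/pNNN.txt` = TEXT OF RECORD, RULINGS v1.35 (3),
SOURCED ns-claims-lit-1 g9 10:09:22Z, LOCATORS 787e378f63833ccb); the same record carries V1 (= «Part I»,
small data, the paper's ref. [2]), V2, V3 (lineage, CARD §1). Bib key `Magsanop2026`. UNREFEREED CLAIM
under adjudication (D-0090 NS-claims sweep, cell `ns-claims`, row C145, T3 QUICK, tranche 2) — this file
TYPES the claimed statement and the text's load-bearing sentences as `Prop`s and ASSERTS NONE OF THEM; the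
theorems below are compositions by pure logic, one Grönwall bookkeeping lemma, and the Clay links. Nothing
here is a theorem about Navier–Stokes. [cite: Magsanop2026, abstract p.1; Thm 1 p.2 l.5–10]

**Claimed statement (verbatim, Thm 1 «Main Theorem» p.2 l.5–10).** «For any u₀ ∈ H¹(R³) with ∇·u₀ = 0
and any ν > 0, there exists a unique global smooth solution u ∈ C^∞(R³ × [0,∞)) to the 3D Navier-Stokes
equations.» RENDERING (`ClaimedTheorem = ClaimedExistence ∧ ClaimedUniqueness`): data = SMOOTH
divergence-free `u₀` with `u₀, ∇u₀ ∈ L²` (the tree's `AlZawahreh2026.IsH1Datum`; for a non-smooth `H¹`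
datum the printed «u ∈ C^∞(R³ × [0,∞))» fails at `t = 0` trivially, so the smooth reading is the
charitable one — precedent `Bledsoe2026`); solution = the Clay-sense one (`u, p` smooth on the closed
half-space, (1)–(3) with `f ≡ 0`, bounded energy (7) — the paper's solutions carry `E(t) ≤ E(0)`, p.3
l.64, Thm 2); «unique» = two such solutions from one datum coincide. `ClaimedExistence` is token for
token `AlZawahreh2026.claySpecH1.Regularity` (`claimedExistence_iff`).

**Clay delta (reference `Literature.Claims.NS.ClayVariants`).** Nearest statement (A) `clayR3.Regularity`.
Δ1 ℝ³ ✓ · Δ2 NSE ✓ · Δ3 `f ≡ 0` ✓ · Δ4 data `H¹ ∩ C^∞ ∩ {∇·u₀ = 0}` ⊋ class (4) — (A)-STRONGER ·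
Δ5/Δ6 conclusion smooth on `ℝ³ × [0,∞)` (+ «unique»; energy clause not printed in Thm 1, carried by the
paper's `E(t) ≤ E(0)`) · Δ7 every `ν > 0` ✓ · Δ8 n/a. No wrong-problem axis on the 3-D chain (§5 «4D
viscous extension», p.4 l.26–p.5, is printed AFTER «QED» p.4 l.14 and is not used by §§1–4; not typed).
`clay_of_claimed : ClaimedTheorem → clayR3.Regularity` PROVED.

**ORDERED STEP INDEX** (print order = the order of the hypotheses of `claim_of_printed_steps`):
* `Step_Thm2` — Thm 2 «V1 Main Result [2]» p.2 l.30–37 (= §1 p.1 l.35–40): the unconditional algebraic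
  energy-decay RATE `E(t) ≤ E(0)/(1 + ⅔νC₁E(0)^{2/3}t)^{3/2}` «for u₀ ∈ H¹», `C₁ = C₁(E(0))` (Part I
  §3.3 p.3: «depends only on initial energy»; REV 2 — rev 1 had a universal `C₁`, not the print).
* `Step_L22_ineq` — §3 p.2 l.48–p.3 l.16: `d/dt‖ω‖² + ν‖∇ω‖² ≤ Cν⁻³‖∇u‖⁴‖ω‖²` (classical; TRUE-type).
* `Step_energyId` — p.3 l.17–20 «∫₀^∞‖∇u‖²dt = E(0)/ν < ∞» (Leray's energy law as the bound it is used
  as; TRUE-type).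
* `Step_L22_gronwall` — p.3 l.21 «Gronwall implies ‖ω(t)‖_{L²} ≤ C(E₀,ν) for all t ≥ 0», typed at the
  abstract Grönwall grain the sentence invokes (from `y′ ≤ K g² y` and `∫g ≤ I` to a bound on `y`).
* `Step_L22_print` / `Step_L22` — the conclusion of «Lemma 2.2» (so named p.2 l.27, p.3 l.76): the a
  priori enstrophy bound, PRINT face (`C(E₀,ν)` uniform over data of equal initial energy, Remark 1) and
  PER-DATUM face (REF-1's charitable column); `stepL22_of_print`, and
  `stepL22_of_printed : Step_L22_ineq → Step_energyId → Step_L22_gronwall → Step_L22` PROVED.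
* `Step_L24_holder` (alongside, p.3 l.34–49) and `Step_L24_print` / `Step_L24` — «Lemma 2.4» p.3
  l.22–70: the a priori `L²_tH²_x` bound `ν∫₀ᵀ‖Δu‖² ≤ C(E₀,ν)` (print face / per-datum face;
  `stepL24_of_print` PROVED).
* `Step_GN` — p.3 l.71–75 «By Gagliardo-Nirenberg, ‖ω‖_{L∞} ≤ C‖ω‖^{1/2}_{L²}‖Δω‖^{1/2}_{L²}».
* `Step_lapVort` — p.3 l.75 «‖Δω‖_{L²} ≤ C‖Δu‖_{L²}».
* `Step_assembly` — p.3 l.76–100: Hölder in time ⇒ `∫₀^{T₀}‖ω‖_∞ ≤ C(E₀,ν,T₀) < ∞` (`BKMBound`).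
* `Step_BKM` — p.3 l.101–103 with Thm 3 (BKM) p.2 l.39–46: `BKMBound → NoBlowup` («no blow-up occurs on
  [0,T₀] by BKM»).
* `Step_Rem1` / `Step_T0` — Strategy p.2 l.11–12 + Remark 1 p.3 l.104–109: `Step_Thm2 →` «select T₀ such
  that ‖u(T₀)‖_{H¹} falls below the small-data threshold».
* `Step_smallData` — p.2 l.11–12 «For t > T₀, global existence follows from small data theory»
  (classical; TRUE-type).
* `Step_glue` — p.2 l.11–13: `NoBlowup → Step_T0 → Step_smallData → ClaimedExistence`.
COMPOSITION: `claim_of_steps`, `claim_of_printed_steps`, `claim_of_print_faces` PROVED (pure logic +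
`stepL22_of_printed` / `stepL22_of_print` / `stepL24_of_print`);
`clay_of_claimed`, `clayA_of_bkmBound` (the target of §3, `BKMBound`, is already Clay (A) on class-(4)
data — tree door `clayR3_regularity_iff_aprioriBKM`) PROVED.

REV 2 (2026-08-27, same typist, minutes after rev 1 p523994; announce-first STATUS 10:35:23Z; REF-1 RETYPE
v0.0 F2): `Step_Thm2` re-typed with `C₁ = C₁(E(0))`; `Step_L22_print`, `Step_L24_print` (constants uniform
over data of equal initial energy, as printed) + `stepL22_of_print`, `stepL24_of_print`,
`claim_of_print_faces` ADDED; every other declaration byte-identical to rev 1.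

Typist's advisory flags (docstrings; the verdict is the refuter's, nothing is asserted): `Step_Thm2`
SUSPICIOUS (a uniform algebraic `L²`-decay rate over all data of a given energy; Schonbek);
`Step_L22_print` / `Step_L24_print` SUSPICIOUS (a constant uniform over all data of equal ENERGY bounds
the enstrophy at `t = 0` — data of fixed energy have unbounded enstrophy under `x ↦ λx` rescaling of a
bump at fixed `L²` mass); `Step_L22_gronwall` SUSPICIOUS (Grönwall needs `∫‖∇u‖⁴`, the energy law gives `∫‖∇u‖²`);
`Step_GN` SUSPICIOUS (the exponent pair `½, ½` is the two-dimensional one; in `ℝ³` dilation `x ↦ λx`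
changes the two sides at different rates); `Step_lapVort` SUSPICIOUS (one derivative short; dilation);
`Step_L24_holder` SUSPICIOUS (dilation); `Step_T0` SUSPICIOUS («E(T₀) small» is converted into
«‖u(T₀)‖_{H¹} small»); `Step_L22`, `Step_L24`, `BKMBound` are a-priori bounds of summit strength on
class-(4) data (`clayA_of_bkmBound`). TRUE-type: `Step_L22_ineq`, `Step_energyId`, `Step_smallData`,
`Step_BKM`, `Step_assembly`, `Step_glue`, `ClaimedUniqueness` (classical; not discharged here).

D-0026: every `def … : Prop` below is a HYPOTHESIS of the claim under adjudication (statement typing),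
not a Literature fact; no instance, no notation, no axiom, no sorry.

WHAT THIS IS NOT: not a claim about NS regularity or blow-up; not a claim about any author beyond the
typed locator.
-/

noncomputable section

open Set MeasureTheory Literature.Analysis.FluidPDE
open scoped ENNReal NNReal ContDiff RealInnerProductSpace Laplacian

namespace Literature.Claims.NS.Magsanop2026

open Literature.Analysis.FluidPDE Literature.Claims.NS.ClayVariants

/-! ## Vocabulary -/

/-- Physical space `ℝ³`. [folklore] -/
abbrev E3 : Type := EuclideanSpace ℝ (Fin 3)

/-- **The datum class of Thm 1** «u₀ ∈ H¹(R³) with ∇·u₀ = 0» (p.2 l.5–7), in the smooth reading forced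
by the printed conclusion «u ∈ C^∞(R³ × [0,∞))»: smooth, divergence free, `u₀, ∇u₀ ∈ L²`
(tree `AlZawahreh2026.IsH1Datum`). [cite: Magsanop2026, Thm 1 p.2 l.5–7; §1 (1) p.1 l.23–27] -/
def IsDatum (u₀ : E3 → E3) : Prop :=
  ContDiff ℝ ∞ u₀ ∧ NSWave0.IsDivFree u₀ ∧ AlZawahreh2026.IsH1Datum u₀

/-- **The class the printed argument runs in**: «Let T* be maximal existence time» (Thm 3 p.2 l.39–41),
«preventing blow-up on [0,T₀]» (p.2 l.12–13): a classical solution of (1) with `f ≡ 0` on `ℝ³ × [0,T)`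
from the datum, with finite energy on `[0,T)` (the paper's `E(t)`, `E₀` are finite: Thm 2, p.3 l.64
«E(t) ≤ E(0)»). [cite: Magsanop2026, Thm 3 p.2 l.39–46; Strategy p.2 l.11–13; p.3 l.64] -/
structure IsSol (ν T : ℝ) (u₀ : E3 → E3) (u : ℝ → E3 → E3) (p : ℝ → E3 → ℝ) : Prop where
  classical : IsClassicalNSSolutionOn (Ico 0 T) ν 0 u p
  initial : u 0 = u₀
  energy : ∃ A : ℝ≥0∞, A < ⊤ ∧ ∀ t ∈ Ico 0 T, ∫⁻ x, ‖u t x‖ₑ ^ 2 ≤ A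

/-- `E(t)` = kinetic energy `½∫|u|²` (p.1 l.35–40, Thm 2 p.2; «initial energy E₀» Remark 1 p.3 l.105) —
the tree's `VectorCalculus.kineticEnergy`. [cite: Magsanop2026, Thm 2 p.2 l.30–37; Remark 1 p.3 l.104–105] -/
abbrev energy (v : E3 → E3) : ℝ := VectorCalculus.kineticEnergy v

/-- `‖ω‖²_{L²} = ∫|curl v|²` (p.2 l.52–59). [cite: Magsanop2026, §3 p.2 l.48–59] -/
def vortSq (v : E3 → E3) : ℝ := ∫ x, ‖curl v x‖ ^ 2

/-- `‖∇v‖²_{L²} = ∫|∇v|²` (Hilbert–Schmidt square; p.3 l.11–21) — the tree's `VectorCalculus.gradNormSq`;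
used with `v = u(t)` («‖∇u‖_{L²}») and `v = ω(t)` («‖∇ω‖_{L²}»). [cite: Magsanop2026, §3 p.3 l.6–21] -/
abbrev gradSq (v : E3 → E3) : ℝ := VectorCalculus.gradNormSq v

/-- `‖Δv‖²_{L²} = ∫|Δv|²` (p.3 l.23–70; with `v = ω`, p.3 l.73–75). [cite: Magsanop2026, §3 p.3 l.22–75] -/
def lapSq (v : E3 → E3) : ℝ := ∫ x, ‖(Δ v) x‖ ^ 2

/-- `‖v‖²_{H¹} = ∫|v|² + ∫|∇v|²` («‖u(T₀)‖_{H¹}», Remark 1 p.3 l.108). [cite: Magsanop2026, Remark 1 p.3 l.107–109] -/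
def h1Sq (v : E3 → E3) : ℝ := (∫ x, ‖v x‖ ^ 2) + gradSq v

/-- The fields the pointwise/functional inequalities of p.3 are applied to at `t = 0` already: smooth,
compactly supported (hence `H¹`, hence data of Thm 1 when divergence free, and the `t = 0` slice of the
class solution they launch). Refuting a universal inequality on this subclass refutes the print.
[cite: Magsanop2026, §3 p.3 l.34–75] -/
def IsTestField (v : E3 → E3) : Prop :=
  ContDiff ℝ ∞ v ∧ HasCompactSupport v

/-- A Clay-sense solution from `u₀` (what «global smooth solution» delivers in the paper's energy class):
`u, p ∈ C^∞(ℝ³ × [0,∞))`, (1)–(3) with `f ≡ 0`, bounded energy (7). [cite: Magsanop2026, Thm 1 p.2 l.5–10; p.3 l.64] -/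
def IsGlobalSol (ν : ℝ) (u₀ : E3 → E3) (u : ℝ → E3 → E3) (p : ℝ → E3 → ℝ) : Prop :=
  IsSmoothOnHalfSpace u ∧ IsSmoothOnHalfSpace p ∧ IsNavierStokesSolution ν 0 u₀ u p ∧ HasBoundedEnergy u

/-! ## The claimed statement -/

/-- **Thm 1, existence half** (p.2 l.5–10): every datum of the class launches a global Clay-sense solution.
[claim: Magsanop2026, status: under-review] [cite: Magsanop2026, Thm 1 p.2 l.5–10] -/
def ClaimedExistence : Prop :=
  ∀ ν : ℝ, 0 < ν → ∀ u₀ : E3 → E3, IsDatum u₀ →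
    ∃ (u : ℝ → E3 → E3) (p : ℝ → E3 → ℝ), IsGlobalSol ν u₀ u p

/-- **Thm 1, the word «unique»** (p.2 l.8): two global Clay-sense solutions from one datum of the class
have the same velocity. Classical (weak–strong uniqueness; for class-(4) data it is the tree theorem
`IsNavierStokesSolution.ae_eq_of_isLerayHopfOn`); TRUE-type, not discharged here.
[claim: Magsanop2026, status: under-review] [cite: Magsanop2026, Thm 1 p.2 l.5–10] -/
def ClaimedUniqueness : Prop :=
  ∀ ν : ℝ, 0 < ν → ∀ u₀ : E3 → E3, IsDatum u₀ →
    ∀ (u₁ : ℝ → E3 → E3) (p₁ : ℝ → E3 → ℝ) (u₂ : ℝ → E3 → E3) (p₂ : ℝ → E3 → ℝ),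
      IsGlobalSol ν u₀ u₁ p₁ → IsGlobalSol ν u₀ u₂ p₂ → ∀ t : ℝ, 0 ≤ t → u₁ t = u₂ t

/-- **CLAIMED THEOREM = Thm 1 «Main Theorem» p.2 l.5–10, as printed (smooth-data reading)**: existence
and uniqueness of a global smooth solution for every divergence-free `u₀ ∈ H¹(ℝ³)` and every `ν > 0`.
[claim: Magsanop2026, status: under-review] [cite: Magsanop2026, Thm 1 p.2 l.5–10; abstract p.1 l.10–17; §4 p.4 l.10–14] -/
def ClaimedTheorem : Prop :=
  ClaimedExistence ∧ ClaimedUniqueness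

/-- The existence half is token for token the `H¹` Clay-schema statement already in the tree
(`AlZawahreh2026.claySpecH1.Regularity`). [cite: Magsanop2026, Thm 1 p.2 l.5–10] -/
theorem claimedExistence_iff : ClaimedExistence ↔ AlZawahreh2026.claySpecH1.Regularity := by
  constructor
  · intro h ν hν u₀ hs hd hH
    exact h ν hν u₀ ⟨hs, hd, hH⟩
  · rintro h ν hν u₀ ⟨hs, hd, hH⟩
    exact h ν hν u₀ hs hd hH

/-- **Clay link**: the claimed theorem implies Clay (A) — a class-(4) datum is a smooth `H¹` datum and
the solution notion is Fefferman's; PROVED (the claim is (A)-STRONGER on Δ4, no wrong-problem axis).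
[cite: Magsanop2026, abstract p.1 l.16–17 «resolves the large data case of the Clay Millennium Problem»] [cite: FeffermanClay2006, (A) p.2] -/
theorem clay_of_claimed (h : ClaimedTheorem) : clayR3.Regularity :=
  AlZawahreh2026.clay_of_claimed (claimedExistence_iff.1 h.1)

/-! ## The Steps of the printed argument (nothing asserted) -/

/-- **Step — Theorem 2 «V1 Main Result [2]», p.2 l.30–37** (restated from §1 p.1 l.35–40 «In Part I of
this work [2], we established energy decay for arbitrary large data»): «For u₀ ∈ H¹,
E(t) ≤ E(0)/(1 + ⅔νC₁E(0)^{2/3}t)^{3/2}.» TYPED as printed, with the constant's printed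
dependence **`C₁ = C₁(E(0))`** («C₁ > 0 depends only on initial energy», Part I = record file v1, §3.3
p.3 l.5–9; V4 prints `C₁` bare): for every initial energy `E₀` ONE constant `C₁ > 0`, then for every
`ν > 0`, every datum of the class with `E(0) = E₀` and every class solution on `[0,T)` from it, the rate
at every `t ∈ [0,T)` (`E` = kinetic energy `½∫|u|²`). (Rev 1 typed a universal `C₁`; that is NOT the
print — REF-1 RETYPE v0.0 F2 — and was re-typed here.) Typist's flag: SUSPICIOUS — an algebraic `L²`
decay rate uniform over all data of a given energy (Schonbek: no uniform `L²`-decay rate on `L²`/`H¹`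
data); NOT reachable by the one-parameter Navier–Stokes scaling alone (it changes `E(0)`). This is the
chain's declared foundation («Building on the unconditional energy decay … established in Part I»,
abstract p.1 l.13). [claim: Magsanop2026, status: under-review] [cite: Magsanop2026, Thm 2 p.2 l.30–37; §1 p.1 l.35–40; Part I (record file v1) §3.3–3.4 p.3 l.5–13] -/
def Step_Thm2 : Prop :=
  ∀ E₀ : ℝ, ∃ C₁ : ℝ, 0 < C₁ ∧ ∀ ν : ℝ, 0 < ν → ∀ u₀ : E3 → E3, IsDatum u₀ → energy u₀ = E₀ →
    ∀ (T : ℝ) (u : ℝ → E3 → E3) (p : ℝ → E3 → ℝ), IsSol ν T u₀ u p → ∀ t ∈ Ico 0 T,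
      energy (u t) ≤ E₀ / (1 + 2 / 3 * ν * C₁ * E₀ ^ (2 / 3 : ℝ) * t) ^ (3 / 2 : ℝ)

/-- **Step — §3 first display block, p.2 l.48 – p.3 l.16** («Taking curl … Multiplying by ω and
integrating … ½ d/dt‖ω‖² + ν‖∇ω‖² = ∫(ω·∇)u·ω … By Hölder … Using Ladyzhenskaya
‖ω‖_{L⁴} ≤ C‖ω‖^{1/4}_{L²}‖∇ω‖^{3/4}_{L²} and Young inequality,
d/dt‖ω‖²_{L²} + ν‖∇ω‖²_{L²} ≤ Cν⁻³‖∇u‖⁴_{L²}‖ω‖²_{L²}»): ONE absolute `C > 0`; along every class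
solution `t ↦ ‖ω(t)‖²_{L²}` is continuous on `[0,T)`, differentiable on `(0,T)`, and obeys the display.
Classical enstrophy inequality; typist's flag: TRUE-type (not discharged).
[claim: Magsanop2026, status: under-review] [cite: Magsanop2026, §3 p.2 l.48 – p.3 l.16] -/
def Step_L22_ineq : Prop :=
  ∃ C : ℝ, 0 < C ∧ ∀ ν : ℝ, 0 < ν → ∀ u₀ : E3 → E3, IsDatum u₀ →
    ∀ (T : ℝ) (u : ℝ → E3 → E3) (p : ℝ → E3 → ℝ), IsSol ν T u₀ u p →
      ContinuousOn (fun t => vortSq (u t)) (Ico 0 T) ∧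
      ∀ t ∈ Ioo 0 T, DifferentiableAt ℝ (fun s => vortSq (u s)) t ∧
        deriv (fun s => vortSq (u s)) t + ν * gradSq (curl (u t)) ≤
          C * ν⁻¹ ^ 3 * gradSq (u t) ^ 2 * vortSq (u t)

/-- **Step — p.3 l.17–20 «Since ∫₀^∞‖∇u‖²_{L²}dt = E(0)/ν < ∞»**: Leray's energy law in the form the
sentence uses — along every class solution `t ↦ ‖∇u(t)‖²_{L²}` is integrable on `[0,T)` with integral
`≤ E(0)/ν` (`E = ½∫|u|²`). Classical (tree: `isLerayHopfOn_of_finiteEnergy` energy inequality, up to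
the identification of the weak gradient); typist's flag: TRUE-type (not discharged).
[claim: Magsanop2026, status: under-review] [cite: Magsanop2026, §3 p.3 l.17–20] -/
def Step_energyId : Prop :=
  ∀ ν : ℝ, 0 < ν → ∀ u₀ : E3 → E3, IsDatum u₀ →
    ∀ (T : ℝ) (u : ℝ → E3 → E3) (p : ℝ → E3 → ℝ), IsSol ν T u₀ u p →
      IntegrableOn (fun t => gradSq (u t)) (Ico 0 T) ∧ ∫ t in Ico 0 T, gradSq (u t) ≤ energy u₀ / ν

/-- **Step — p.3 l.21 «Gronwall implies ‖ω(t)‖_{L²} ≤ C(E₀,ν) for all t ≥ 0»**, typed at the abstract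
Grönwall grain the sentence invokes: from `y′ ≤ K·g²·y` on `(0,T)` (the display above with
`y = ‖ω‖²_{L²}`, `g = ‖∇u‖²_{L²}`, `K = Cν⁻³`), `y ≥ 0`, `y(0) ≤ y₀`, `g ≥ 0` and `∫₀ᵀ g ≤ I` (the energy
law), a bound `y(t) ≤ B` on `[0,T)` with `B` depending only on `(K, I, y₀)` — CHARITABLY letting `B`
depend on `y₀ = ‖ω₀‖²` as well (the print's `C(E₀,ν)` does not). Typist's flag: SUSPICIOUS — Grönwall
would need `∫ g²`, not `∫ g`. [claim: Magsanop2026, status: under-review] [cite: Magsanop2026, §3 p.3 l.17–21] -/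
def Step_L22_gronwall : Prop :=
  ∀ K I y₀ : ℝ, 0 ≤ K → 0 ≤ I → 0 ≤ y₀ → ∃ B : ℝ,
    ∀ (T : ℝ) (y g : ℝ → ℝ), ContinuousOn y (Ico 0 T) →
      (∀ t ∈ Ioo 0 T, DifferentiableAt ℝ y t ∧ deriv y t ≤ K * g t ^ 2 * y t) →
      (∀ t ∈ Ico 0 T, 0 ≤ y t) → y 0 ≤ y₀ → (∀ t, 0 ≤ g t) →
      IntegrableOn g (Ico 0 T) → ∫ t in Ico 0 T, g t ≤ I →
        ∀ t ∈ Ico 0 T, y t ≤ B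

/-- **Step — «Lemma 2.2» (so called p.2 l.27, p.3 l.76), its conclusion p.3 l.21**: the a priori
ENSTROPHY BOUND «‖ω(t)‖_{L²} ≤ C(E₀,ν) for all t ≥ 0» — for every `ν > 0` and datum there is `C` with
`‖ω(t)‖²_{L²} ≤ C` along every class solution from it — the PER-DATUM face = REF-1's CHARITABLE column
(`C` may depend on the datum; the print's `C(E₀,ν)` is `Step_L22_print` below). On class-(4) data an a
priori enstrophy bound is of summit strength (`ClayVariants.clayR3_regularity_iff_aprioriEnstrophyBound`). [claim: Magsanop2026, status: under-review] [cite: Magsanop2026, §3 p.3 l.21; p.2 l.27; Remark 1 p.3 l.104–105] -/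
def Step_L22 : Prop :=
  ∀ ν : ℝ, 0 < ν → ∀ u₀ : E3 → E3, IsDatum u₀ → ∃ C : ℝ,
    ∀ (T : ℝ) (u : ℝ → E3 → E3) (p : ℝ → E3 → ℝ), IsSol ν T u₀ u p → ∀ t ∈ Ico 0 T, vortSq (u t) ≤ C

/-- **«Lemma 2.2», PRINT FACE** (p.3 l.21 «‖ω(t)‖_{L²} ≤ C(E₀,ν) for all t ≥ 0» with Remark 1 p.3 l.104–105
«The constants C in Lemma 2.2 and Theorem 1 depend only on the initial energy E₀ and viscosity ν»): the
constant is UNIFORM over all data of the class with the same initial energy — `∀ ν > 0, ∀ E₀, ∃ C, ∀`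
datum with `E(0) = E₀`, `∀` class solution, `∀ t`, `‖ω(t)‖²_{L²} ≤ C` (REF-1 RETYPE v0.0 §2
`Step22_print`). `Step_L22_print → Step_L22` (`stepL22_of_print`). [claim: Magsanop2026, status: under-review]
[cite: Magsanop2026, §3 p.3 l.21; Remark 1 p.3 l.104–105] -/
def Step_L22_print : Prop :=
  ∀ ν : ℝ, 0 < ν → ∀ E₀ : ℝ, ∃ C : ℝ, ∀ u₀ : E3 → E3, IsDatum u₀ → energy u₀ = E₀ →
    ∀ (T : ℝ) (u : ℝ → E3 → E3) (p : ℝ → E3 → ℝ), IsSol ν T u₀ u p → ∀ t ∈ Ico 0 T, vortSq (u t) ≤ C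

/-- **Alongside — p.3 l.34–49, the Hölder–Sobolev display of «Lemma 2.4»**: «|∫(u·∇)u·Δu| ≤
‖u‖_{L⁶}‖∇u‖_{L³}‖Δu‖_{L²} ≤ CE(t)^{3/4}‖Δu‖^{3/2}_{L²}» — the composite inequality with ONE absolute
`C`, on test fields (smooth, compactly supported, divergence free = `t = 0` slices of class solutions).
Typist's flag: SUSPICIOUS (under `x ↦ λx` the two sides scale differently: `E` is the ENERGY, where the
standard estimate has `‖∇u‖²_{L²}`). Not consumed by `claim_of_steps` (it delivers `Step_L24`).
[claim: Magsanop2026, status: under-review] [cite: Magsanop2026, §3 p.3 l.34–49] -/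
def Step_L24_holder : Prop :=
  ∃ C : ℝ, 0 < C ∧ ∀ v : E3 → E3, IsTestField v → NSWave0.IsDivFree v →
    |∫ x, ⟪convect v v x, (Δ v) x⟫| ≤ C * energy v ^ (3 / 4 : ℝ) * lapSq v ^ (3 / 4 : ℝ)

/-- **Step — «Lemma 2.4» (so called p.3 l.76), p.3 l.22–70** («Multiply NSE by −Δu and integrate …
Young with p = 4/3 … Integrating from 0 to T and using E(t) ≤ E(0) from V1 gives
ν∫₀ᵀ‖Δu‖²_{L²}dt ≤ E(0) + Cν⁻⁴E(0)³ ≤ C(E₀,ν)»): the a priori `L²_tH²_x` bound — for every `ν > 0` and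
datum there is `C` with `ν∫₀ᵀ‖Δu‖² ≤ C` along every class solution on every `[0,T)` — the
PER-DATUM face = REF-1's charitable column (the print's `C(E₀,ν)` is `Step_L24_print` below). Summit
strength on class-(4) data. [claim: Magsanop2026, status: under-review]
[cite: Magsanop2026, §3 p.3 l.22–70] -/
def Step_L24 : Prop :=
  ∀ ν : ℝ, 0 < ν → ∀ u₀ : E3 → E3, IsDatum u₀ → ∃ C : ℝ,
    ∀ (T : ℝ) (u : ℝ → E3 → E3) (p : ℝ → E3 → ℝ), IsSol ν T u₀ u p →
      IntegrableOn (fun t => lapSq (u t)) (Ico 0 T) ∧ ν * ∫ t in Ico 0 T, lapSq (u t) ≤ C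

/-- **«Lemma 2.4», PRINT FACE** (p.3 l.64–70 «ν∫₀ᵀ‖Δu‖²_{L²}dt ≤ E(0) + Cν⁻⁴E(0)³ ≤ C(E₀, ν)»): the
constant is UNIFORM over all data of the class with the same initial energy and over `T` —
`∀ ν > 0, ∀ E₀, ∃ C, ∀` datum with `E(0) = E₀`, `∀` class solution on `[0,T)`, `ν∫₀ᵀ‖Δu‖² ≤ C`
(REF-1 RETYPE v0.0 §2 `Step24_print`). `Step_L24_print → Step_L24` (`stepL24_of_print`).
[claim: Magsanop2026, status: under-review] [cite: Magsanop2026, §3 p.3 l.64–70; Remark 1 p.3 l.104–105] -/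
def Step_L24_print : Prop :=
  ∀ ν : ℝ, 0 < ν → ∀ E₀ : ℝ, ∃ C : ℝ, ∀ u₀ : E3 → E3, IsDatum u₀ → energy u₀ = E₀ →
    ∀ (T : ℝ) (u : ℝ → E3 → E3) (p : ℝ → E3 → ℝ), IsSol ν T u₀ u p →
      IntegrableOn (fun t => lapSq (u t)) (Ico 0 T) ∧ ν * ∫ t in Ico 0 T, lapSq (u t) ≤ C

/-- **Step — p.3 l.71–75 «By Gagliardo-Nirenberg, ‖ω‖_{L∞} ≤ C‖ω‖^{1/2}_{L²}‖Δω‖^{1/2}_{L²}»**: ONE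
absolute `C`, for every smooth compactly supported field `w` on `ℝ³` (the print applies it to `ω(t)`;
compactly supported smooth fields are among the admissible `ω(0) = curl u₀`). Typist's flag: SUSPICIOUS —
`(½, ½)` is the TWO-dimensional exponent pair (Brezis–Gallouet/2-D Agmon); in `ℝ³` the dilations
`w(λ·)` leave the left side fixed and send the right side to `0` (`λ^{-1/2}`); the 3-D Agmon pair is
`(¼, ¾)`. [claim: Magsanop2026, status: under-review] [cite: Magsanop2026, §3 p.3 l.71–75] -/
def Step_GN : Prop :=
  ∃ C : ℝ, 0 < C ∧ ∀ w : E3 → E3, IsTestField w →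
    ∀ x, ‖w x‖ ≤ C * (∫ y, ‖w y‖ ^ 2) ^ (1 / 4 : ℝ) * lapSq w ^ (1 / 4 : ℝ)

/-- **Step — p.3 l.75 «Since ‖Δω‖_{L²} ≤ C‖Δu‖_{L²}»** (`ω = curl u`): ONE absolute `C`, for every
smooth compactly supported `u` on `ℝ³` (squared form). Typist's flag: SUSPICIOUS — the left side carries
one more derivative (`Δ curl u` vs `Δu`); dilation `u(λ·)` multiplies the ratio by `λ²`.
[claim: Magsanop2026, status: under-review] [cite: Magsanop2026, §3 p.3 l.75] -/
def Step_lapVort : Prop :=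
  ∃ C : ℝ, 0 < C ∧ ∀ v : E3 → E3, IsTestField v → lapSq (curl v) ≤ C * lapSq v

/-- **The BKM integral bound (2) p.4 l.1–4 / p.3 l.77–100** «∫₀^{T₀}‖ω‖_{L∞}dt ≤ … ≤ C(E₀,ν,T₀) < ∞»,
in the form Thm 3 consumes: along every class solution on every `[0,T)` the Beale–Kato–Majda integral
`∫₀ᵀ sup_x|ω| dt` is finite (tree rendering `∫⁻_{(0,T)} ⨆ₓ ‖curl u(t,x)‖ₑ < ⊤`, as in
`clayR3_regularity_iff_aprioriBKM`). [claim: Magsanop2026, status: under-review] [cite: Magsanop2026, (2) p.4 l.1–4; §3 p.3 l.77–103] -/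
def BKMBound : Prop :=
  ∀ ν : ℝ, 0 < ν → ∀ u₀ : E3 → E3, IsDatum u₀ →
    ∀ (T : ℝ) (u : ℝ → E3 → E3) (p : ℝ → E3 → ℝ), IsSol ν T u₀ u p →
      (∫⁻ t in Ioo 0 T, ⨆ x, ‖curl (u t) x‖ₑ) < ⊤

/-- **Step — p.3 l.76–100, the assembly** («using Lemma 2.2 and Lemma 2.4,
∫₀^{T₀}‖ω‖_∞ ≤ C∫₀^{T₀}‖ω‖^{1/2}_{L²}‖Δu‖^{1/2}_{L²} ≤ C sup_{[0,T₀]}‖ω‖^{1/2}_{L²}(∫₀^{T₀}‖Δu‖²)^{1/4}T₀^{1/2}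
≤ C(E₀,ν,T₀) < ∞»): typed as the implication the lines assert — the two lemmas and the two displays of
l.71–75 give the BKM bound. Hölder-in-time bookkeeping; TRUE-type as an inference (not discharged).
[claim: Magsanop2026, status: under-review] [cite: Magsanop2026, §3 p.3 l.76–100] -/
def Step_assembly : Prop :=
  Step_L22 → Step_L24 → Step_GN → Step_lapVort → BKMBound

/-- **«no blow-up occurs on [0,T₀]»** (p.3 l.101–103): for every `ν > 0`, datum and `T₀ > 0` there is a
finite-energy classical solution from the datum on the CLOSED slab `[0,T₀] × ℝ³`.
[claim: Magsanop2026, status: under-review] [cite: Magsanop2026, §3 p.3 l.101–103; Strategy p.2 l.12–13] -/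
def NoBlowup : Prop :=
  ∀ ν : ℝ, 0 < ν → ∀ u₀ : E3 → E3, IsDatum u₀ → ∀ T₀ : ℝ, 0 < T₀ →
    ∃ (u : ℝ → E3 → E3) (p : ℝ → E3 → ℝ), IsClassicalNSSolutionOn (Icc 0 T₀) ν 0 u p ∧ u 0 = u₀ ∧
      ∃ A : ℝ≥0∞, A < ⊤ ∧ ∀ t ∈ Icc 0 T₀, ∫⁻ x, ‖u t x‖ₑ ^ 2 ≤ A

/-- **Step — Thm 3 (Beale–Kato–Majda [3]) p.2 l.39–46 as used p.3 l.101–103** («Hence ∫₀^{T₀}‖ω‖_∞dt < ∞,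
so no blow-up occurs on [0,T₀] by BKM»): the BKM bound along class solutions gives continuation to every
closed slab. Classical (BKM 1984 + local theory; for class-(4) data it is the tree door
`clayR3_regularity_iff_aprioriBKM`, see `clayA_of_bkmBound`); TRUE-type as an inference (not discharged
on the `H¹ ∩ C^∞` data class). [claim: Magsanop2026, status: under-review] [cite: Magsanop2026, Thm 3 p.2 l.39–46; §3 p.3 l.101–103] -/
def Step_BKM : Prop :=
  BKMBound → NoBlowup

/-- **Step — «there exists finite T₀ such that … ‖u(T₀)‖_{H¹} falls below the small-data threshold»
(Strategy p.2 l.11–12 «By Part I, there exists finite T₀ such that E(T₀) is arbitrarily small»; Remark 1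
p.3 l.107–109 «This decay is sufficient to select T₀ such that ‖u(T₀)‖_{H¹} falls below the small-data
threshold»)**: for every `ν > 0`, threshold `δ > 0` and datum there is a finite `T₀ ≥ 0` (selected from
`E₀, ν` via the rate — Remark 1 l.104–105) such that every class solution living past `T₀` has
`‖u(T₀)‖²_{H¹} < δ`. Typist's flag: SUSPICIOUS — the rate controls `E(T₀) = ½‖u(T₀)‖²_{L²}`, not
`‖∇u(T₀)‖_{L²}`. [claim: Magsanop2026, status: under-review] [cite: Magsanop2026, Strategy p.2 l.11–12; Remark 1 p.3 l.104–109] -/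
def Step_T0 : Prop :=
  ∀ ν : ℝ, 0 < ν → ∀ δ : ℝ, 0 < δ → ∀ u₀ : E3 → E3, IsDatum u₀ → ∃ T₀ : ℝ, 0 ≤ T₀ ∧
    ∀ (T : ℝ) (u : ℝ → E3 → E3) (p : ℝ → E3 → ℝ), IsSol ν T u₀ u p → T₀ < T → h1Sq (u T₀) < δ

/-- **Step — Remark 1 p.3 l.105–109, the inference** «By Part I [2], E(t) ≤ C(1+t)^{−3/2}
unconditionally, ensuring E(t) → 0 … This decay is sufficient to select T₀ …»: Theorem 2 delivers the
selection time. Typed as the implication the sentence asserts. [claim: Magsanop2026, status: under-review]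
[cite: Magsanop2026, Remark 1 p.3 l.105–109; Strategy p.2 l.11] -/
def Step_Rem1 : Prop :=
  Step_Thm2 → Step_T0

/-- **Step — «For t > T₀, global existence follows from small data theory» (p.2 l.11–12)**: for every
`ν > 0` there is a threshold `δ > 0` such that every datum of the class with `‖u₀‖²_{H¹} < δ` launches a
global Clay-sense solution. Classical (Leray 1934 §33 small `‖u₀‖_{L²}‖∇u₀‖_{L²}`, Kato); typist's flag:
TRUE-type (not discharged; barrier record `SmallDataGlobalRegularity`).
[claim: Magsanop2026, status: under-review] [cite: Magsanop2026, Strategy p.2 l.11–12; Remark 1 p.3 l.108] -/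
def Step_smallData : Prop :=
  ∀ ν : ℝ, 0 < ν → ∃ δ : ℝ, 0 < δ ∧ ∀ v₀ : E3 → E3, IsDatum v₀ → h1Sq v₀ < δ →
    ∃ (u : ℝ → E3 → E3) (p : ℝ → E3 → ℝ), IsGlobalSol ν v₀ u p

/-- **Step — the Strategy's gluing, p.2 l.11–13** («By Part I, there exists finite T₀ … For t > T₀,
global existence follows from small data theory. The critical barrier is preventing blow-up on [0,T₀]»):
no blow-up on `[0,T₀]` + the selection of `T₀` + small-data theory from `u(T₀)` give the global
solution (restart at `T₀` and uniqueness of the continuation; classical bookkeeping). Typed as the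
implication the lines assert; TRUE-type (not discharged). [claim: Magsanop2026, status: under-review]
[cite: Magsanop2026, Strategy p.2 l.11–13; §4 p.4 l.10–14] -/
def Step_glue : Prop :=
  NoBlowup → Step_T0 → Step_smallData → ClaimedExistence

/-! ## Kernel relations (pure logic, one bookkeeping lemma, the Clay doors) -/

/-- `‖ω‖²_{L²} ≥ 0` (private helper). [folklore] -/
private theorem vortSq_nonneg (v : E3 → E3) : 0 ≤ vortSq v :=
  integral_nonneg fun _ => by positivity

/-- `‖∇v‖²_{L²} ≥ 0` (private helper). [folklore] -/
private theorem gradSq_nonneg (v : E3 → E3) : 0 ≤ gradSq v :=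
  integral_nonneg fun _ => frobeniusNormSq_nonneg _

/-- **«Lemma 2.2» from its printed derivation (p.2 l.48 – p.3 l.21)**: the enstrophy inequality, the
energy law and the Grönwall sentence (at its abstract grain) give the a priori enstrophy bound — PROVED
bookkeeping (`K = Cν⁻³`, `I = E₀/ν`, `y₀ = ‖ω₀‖²`), so the three printed inputs are on the composition
path. [cite: Magsanop2026, §3 p.2 l.48 – p.3 l.21] -/
theorem stepL22_of_printed (hI : Step_L22_ineq) (hE : Step_energyId) (hG : Step_L22_gronwall) :
    Step_L22 := by
  intro ν hν u₀ hu₀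
  obtain ⟨C, hC, hIneq⟩ := hI
  have hK : 0 ≤ C * ν⁻¹ ^ 3 := by positivity
  have hI0 : 0 ≤ energy u₀ / ν := div_nonneg (kineticEnergy_nonneg _) hν.le
  obtain ⟨B, hB⟩ := hG (C * ν⁻¹ ^ 3) (energy u₀ / ν) (vortSq u₀) hK hI0 (vortSq_nonneg _)
  refine ⟨B, fun T u p hsol t ht => ?_⟩
  obtain ⟨hcont, hder⟩ := hIneq ν hν u₀ hu₀ T u p hsol
  obtain ⟨hint, hle⟩ := hE ν hν u₀ hu₀ T u p hsol
  refine hB T (fun s => vortSq (u s)) (fun s => gradSq (u s)) hcont ?_ (fun s _ => vortSq_nonneg _)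
    (by rw [hsol.initial]) (fun s => gradSq_nonneg _) hint hle t ht
  intro s hs
  obtain ⟨hdiff, hineq⟩ := hder s hs
  refine ⟨hdiff, ?_⟩
  have hνg : 0 ≤ ν * gradSq (curl (u s)) := mul_nonneg hν.le (gradSq_nonneg _)
  linarith

/-- The print face of Lemma 2.2 (constant uniform over data of equal energy) gives the per-datum face.
[cite: Magsanop2026, §3 p.3 l.21] -/
theorem stepL22_of_print (h : Step_L22_print) : Step_L22 := by
  intro ν hν u₀ hu₀
  obtain ⟨C, hC⟩ := h ν hν (energy u₀)
  exact ⟨C, fun T u p hsol t ht => hC u₀ hu₀ rfl T u p hsol t ht⟩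

/-- The print face of Lemma 2.4 gives the per-datum face. [cite: Magsanop2026, §3 p.3 l.64–70] -/
theorem stepL24_of_print (h : Step_L24_print) : Step_L24 := by
  intro ν hν u₀ hu₀
  obtain ⟨C, hC⟩ := h ν hν (energy u₀)
  exact ⟨C, fun T u p hsol => hC u₀ hu₀ rfl T u p hsol⟩

/-- **COMPOSITION — the printed logic composes** (Strategy p.2 l.11–13 with §3): Lemma 2.2, Lemma 2.4,
the two displays of p.3 l.71–75, the assembly, BKM, the selection of `T₀`, small-data theory and the
gluing give the existence half; the uniqueness word is carried as its own hypothesis. PROVED, pure logic;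
nothing asserted. [cite: Magsanop2026, Strategy p.2 l.11–27; §3 pp.2–4; §4 p.4 l.10–14] -/
theorem claim_of_steps (h22 : Step_L22) (h24 : Step_L24) (hGN : Step_GN) (hLV : Step_lapVort)
    (hA : Step_assembly) (hB : Step_BKM) (hT0 : Step_T0) (hSD : Step_smallData) (hG : Step_glue)
    (hU : ClaimedUniqueness) : ClaimedTheorem :=
  ⟨hG (hB (hA h22 h24 hGN hLV)) hT0 hSD, hU⟩

/-- **COMPOSITION from the printed inputs in print order** (Thm 2 p.2 → §3 p.2–3 → (2) p.4 → Strategy /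
Remark 1 → small data → glue → «unique»): PROVED via `stepL22_of_printed`; nothing asserted.
[cite: Magsanop2026, Thm 2 p.2 l.30–37; §3 pp.2–3; Remark 1 p.3; Strategy p.2 l.11–13] -/
theorem claim_of_printed_steps (hT2 : Step_Thm2) (hI : Step_L22_ineq) (hE : Step_energyId)
    (hGr : Step_L22_gronwall) (h24 : Step_L24) (hGN : Step_GN) (hLV : Step_lapVort)
    (hA : Step_assembly) (hB : Step_BKM) (hR1 : Step_Rem1) (hSD : Step_smallData) (hG : Step_glue)
    (hU : ClaimedUniqueness) : ClaimedTheorem :=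
  claim_of_steps (stepL22_of_printed hI hE hGr) h24 hGN hLV hA hB (hR1 hT2) hSD hG hU

/-- **COMPOSITION from the PRINT FACES** (constants uniform over data of equal initial energy, as Remark 1
prints): Thm 2 (via Remark 1), Lemma 2.2 and Lemma 2.4 in their print faces, the displays of p.3 l.71–75,
the assembly, BKM, small data, glue, «unique». PROVED, pure logic; nothing asserted.
[cite: Magsanop2026, Thm 2 p.2; §3 p.3 l.21, l.64–70; Remark 1 p.3 l.104–105] -/
theorem claim_of_print_faces (hT2 : Step_Thm2) (h22 : Step_L22_print) (h24 : Step_L24_print)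
    (hGN : Step_GN) (hLV : Step_lapVort) (hA : Step_assembly) (hB : Step_BKM) (hR1 : Step_Rem1)
    (hSD : Step_smallData) (hG : Step_glue) (hU : ClaimedUniqueness) : ClaimedTheorem :=
  claim_of_steps (stepL22_of_print h22) (stepL24_of_print h24) hGN hLV hA hB (hR1 hT2) hSD hG hU

/-- **The target of §3 is already Clay (A) on class-(4) data**: the a priori BKM bound (2) along every
class solution, restricted to Fefferman's data, is equivalent to (A) (tree door
`clayR3_regularity_iff_aprioriBKM`, Beale–Kato–Majda 1984 + Tao 2013 Cor. 11.1); PROVED.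
[cite: Magsanop2026, (2) p.4 l.1–4] [cite: BealeKatoMajda1984, Thm. 1 and Corollary] [cite: FeffermanClay2006, (A) p.2] -/
theorem clayA_of_bkmBound (h : BKMBound) : clayR3.Regularity := by
  refine clayR3_regularity_iff_aprioriBKM.2 fun μ hμ u₀ hu₀ hdiv hdec T u p hcl hu0 hE => ?_
  have hH1 : AlZawahreh2026.IsH1Datum u₀ := fun n _ =>
    HasRapidSpatialDecay.lintegral_enorm_iteratedFDeriv_sq_lt_top (μ := volume) hdec n
  exact h μ hμ u₀ ⟨hu₀, hdiv, hH1⟩ T u p ⟨hcl, hu0, hE⟩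

/-- With the steps, the printed chain would settle Clay (A). [cite: Magsanop2026, §4 p.4 l.13–14] [cite: FeffermanClay2006, (A) p.2] -/
theorem clay_of_steps (h22 : Step_L22) (h24 : Step_L24) (hGN : Step_GN) (hLV : Step_lapVort)
    (hA : Step_assembly) (hB : Step_BKM) (hT0 : Step_T0) (hSD : Step_smallData) (hG : Step_glue)
    (hU : ClaimedUniqueness) : clayR3.Regularity :=
  clay_of_claimed (claim_of_steps h22 h24 hGN hLV hA hB hT0 hSD hG hU)

/-! ## Appendix (ns-claims-typist-6 g6, D-0026 in-file discharge; append-only — nothing above is changed,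
no Step is asserted): the uniqueness half `ClaimedUniqueness` HOLDS

Thm 1's word «unique» (p.2 l.5–10), typed as `ClaimedUniqueness` and carried by `claim_of_steps` as its
own binder `hU`, is a THEOREM of the tree for the class typed here (Fefferman's smooth finite-energy
solutions (6)/(7) of the unforced system, smooth `H¹` data): Tao 2013 Cor. 11.4,
`IsClassicalNSSolutionOn.eq_of_finiteEnergy`. The composition is re-stated without the binder
(`claim_of_steps'`, `clay_of_steps'`). The locator of record (#132, `Step_Thm2`) is untouched. -/

/-- **`ClaimedUniqueness` HOLDS (kernel)** — two global smooth finite-energy solutions (Fefferman (6)/(7))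
of the unforced system from the same smooth `H¹` datum coincide at every `t ≥ 0`: Tao 2013 Cor. 11.4 in
the tree (`IsClassicalNSSolutionOn.eq_of_finiteEnergy`, restricting both solutions to `[0, t]`), with
`∇u₀ ∈ L²` read off the `IsH1Datum` clause of `IsDatum` and the Clay-shape ↔ classical bridge
`isNavierStokesSolution_and_smooth_iff`. [cite: Tao2011, Cor. 11.4 (arXiv Cor. 71)]
[cite: Magsanop2026, Thm 1 p.2 l.5–10] -/
theorem claimedUniqueness_holds : ClaimedUniqueness := by
  intro ν hν u₀ hu₀ u₁ p₁ u₂ p₂ h₁ h₂ t ht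
  obtain ⟨hsm, -, hH⟩ := hu₀
  have hH1 : MemLp (fderiv ℝ u₀) 2 volume := by
    have h1 : ∫⁻ x, ‖fderiv ℝ u₀ x‖ₑ ^ 2 < ⊤ := by
      refine lt_of_le_of_lt (le_of_eq (lintegral_congr fun x => ?_)) (hH 1 le_rfl)
      rw [← ofReal_norm, ← ofReal_norm, norm_iteratedFDeriv_one]
    exact ⟨(hsm.continuous_fderiv (by simp)).aestronglyMeasurable,
      eLpNorm_two_lt_top_of_lintegral_enorm_sq_lt_top h1⟩
  obtain ⟨hs₁, hp₁, hns₁, ⟨A₁, hA₁, hE₁⟩⟩ := h₁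
  obtain ⟨hs₂, hp₂, hns₂, ⟨A₂, hA₂, hE₂⟩⟩ := h₂
  obtain ⟨hc₁, h0₁⟩ := (isNavierStokesSolution_and_smooth_iff (ν := ν) (f := 0) (u₀ := u₀) (u := u₁)
    (p := p₁)).1 ⟨hns₁, hs₁, hp₁⟩
  obtain ⟨hc₂, h0₂⟩ := (isNavierStokesSolution_and_smooth_iff (ν := ν) (f := 0) (u₀ := u₀) (u := u₂)
    (p := p₂)).1 ⟨hns₂, hs₂, hp₂⟩
  rcases ht.eq_or_lt with rfl | ht'
  · rw [h0₁, h0₂]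
  · exact IsClassicalNSSolutionOn.eq_of_finiteEnergy hν hH1
      (hc₁.mono Icc_subset_Ici_self (uniqueDiffOn_Icc ht'))
      (hc₂.mono Icc_subset_Ici_self (uniqueDiffOn_Icc ht')) h0₁ h0₂
      ⟨A₁, hA₁, fun s hs => hE₁ s hs.1⟩ ⟨A₂, hA₂, fun s hs => hE₂ s hs.1⟩ ⟨ht, le_rfl⟩ le_rfl

/-- The claimed theorem is its existence half (uniqueness being a theorem of the tree).
[cite: Magsanop2026, Thm 1 p.2 l.5–10] -/
theorem claimedTheorem_of_existence (h : ClaimedExistence) : ClaimedTheorem :=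
  ⟨h, claimedUniqueness_holds⟩

/-- `claim_of_steps` without the uniqueness binder. [cite: Magsanop2026, Strategy p.2 l.11–27; §4 p.4 l.10–14] -/
theorem claim_of_steps' (h22 : Step_L22) (h24 : Step_L24) (hGN : Step_GN) (hLV : Step_lapVort)
    (hA : Step_assembly) (hB : Step_BKM) (hT0 : Step_T0) (hSD : Step_smallData) (hG : Step_glue) :
    ClaimedTheorem :=
  claim_of_steps h22 h24 hGN hLV hA hB hT0 hSD hG claimedUniqueness_holds

/-- `clay_of_steps` without the uniqueness binder. [cite: Magsanop2026, §4 p.4 l.13–14] [cite: FeffermanClay2006, (A) p.2] -/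
theorem clay_of_steps' (h22 : Step_L22) (h24 : Step_L24) (hGN : Step_GN) (hLV : Step_lapVort)
    (hA : Step_assembly) (hB : Step_BKM) (hT0 : Step_T0) (hSD : Step_smallData) (hG : Step_glue) :
    clayR3.Regularity :=
  clay_of_claimed (claim_of_steps' h22 h24 hGN hLV hA hB hT0 hSD hG)

/-! ## Appendix B (ns-claims-lit-3 g9, D-0026 in-file discharge; append-only — nothing above is changed,
no Step is asserted): the Strategy's gluing `Step_glue` HOLDS, and `ClaimedTheorem ↔ NoBlowup`

The Strategy p.2 l.11–13 routes the global solution through a selection time `T₀` (`Step_T0`) and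
small-data theory (`Step_smallData`). In the class typed here both detours are logically idle: the
sentence «no blow-up occurs on [0,T₀]» for EVERY `T₀` (`NoBlowup`, p.3 l.101–103) already IS global
existence, because smooth finite-energy solutions of the unforced system from an `H¹` datum are unique on
every common closed slab (Tao 2013, Cor. 11.4) and therefore patch to `[0, ∞)` with Tao's horizon-uniform
energy bound (Lemma 8.1) — the tree's `IsClassicalNSSolutionOn.exists_Ici_of_forall_Icc_finiteEnergy`
(`Literature/Analysis/FluidPDE/ClassicalNSHorizonPatching.lean`), whose hypothesis is `NoBlowup`
token for token. Hence `step_glue_holds`, the equivalence `claimedTheorem_iff_noBlowup`, and the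
composition re-stated on the six §3 binders alone (`claim_of_steps''`). The locator of record (#132,
`Step_Thm2`) and every statement above are untouched. -/

/-- `∇u₀ ∈ L²` for a datum of the class (the `n = 1` clause of `IsH1Datum`). [cite: Magsanop2026, Thm 1 p.2 l.5–7] -/
theorem IsDatum.memLp_fderiv {u₀ : E3 → E3} (hu₀ : IsDatum u₀) : MemLp (fderiv ℝ u₀) 2 volume := by
  obtain ⟨hsm, -, hH⟩ := hu₀
  have h1 : ∫⁻ x, ‖fderiv ℝ u₀ x‖ₑ ^ 2 < ⊤ := by
    refine lt_of_le_of_lt (le_of_eq (lintegral_congr fun x => ?_)) (hH 1 le_rfl)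
    rw [← ofReal_norm, ← ofReal_norm, norm_iteratedFDeriv_one]
  exact ⟨(hsm.continuous_fderiv (by simp)).aestronglyMeasurable,
    eLpNorm_two_lt_top_of_lintegral_enorm_sq_lt_top h1⟩

/-- **«no blow-up on every [0,T₀]» gives the existence half of Thm 1 (kernel)**: the per-horizon smooth
finite-energy solutions of `NoBlowup` patch, by uniqueness on common slabs (Tao 2013 Cor. 11.4) and the
horizon-uniform energy bound (Tao 2013 Lemma 8.1), to ONE Clay-sense solution on `ℝ³ × [0,∞)` — tree
`IsClassicalNSSolutionOn.exists_Ici_of_forall_Icc_finiteEnergy`, Clay shape via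
`isNavierStokesSolution_and_smooth_iff`. [cite: Tao2011, Cor. 11.4 (arXiv Cor. 71); Lemma 8.1 (arXiv Lemma 44)]
[cite: Magsanop2026, §3 p.3 l.101–103; Strategy p.2 l.11–13; Thm 1 p.2 l.5–10] -/
theorem claimedExistence_of_noBlowup (h : NoBlowup) : ClaimedExistence := by
  intro ν hν u₀ hu₀
  obtain ⟨u, p, hcl, h0, hE, -⟩ :=
    IsClassicalNSSolutionOn.exists_Ici_of_forall_Icc_finiteEnergy hν hu₀.memLp_fderiv
      fun T hT => h ν hν u₀ hu₀ T hT
  obtain ⟨hns, hs, hp⟩ := (isNavierStokesSolution_and_smooth_iff (ν := ν) (f := 0) (u₀ := u₀) (u := u)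
    (p := p)).2 ⟨hcl, h0⟩
  exact ⟨u, p, hs, hp, hns, hE⟩

/-- **Conversely** a global Clay-sense solution restricts to a smooth finite-energy solution on every closed
slab `[0,T₀]` (the bounded energy (7) restricts). [cite: Magsanop2026, §3 p.3 l.101–103; Thm 1 p.2 l.5–10] -/
theorem noBlowup_of_claimedExistence (h : ClaimedExistence) : NoBlowup := by
  intro ν hν u₀ hu₀ T₀ hT₀
  obtain ⟨u, p, hs, hp, hns, C, hC, hb⟩ := h ν hν u₀ hu₀
  obtain ⟨hcl, h0⟩ := (isNavierStokesSolution_and_smooth_iff (ν := ν) (f := 0) (u₀ := u₀) (u := u)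
    (p := p)).1 ⟨hns, hs, hp⟩
  exact ⟨u, p, hcl.mono Icc_subset_Ici_self (uniqueDiffOn_Icc hT₀), h0, C, hC, fun t ht => hb t ht.1⟩

/-- **`Step_glue` HOLDS (kernel)** — and the two Strategy binders it carries (`Step_T0`, `Step_smallData`)
are not used: `NoBlowup` alone gives `ClaimedExistence`. [cite: Magsanop2026, Strategy p.2 l.11–13; §4 p.4 l.10–14]
[cite: Tao2011, Cor. 11.4 (arXiv Cor. 71); Lemma 8.1 (arXiv Lemma 44)] -/
theorem step_glue_holds : Step_glue := fun hNB _ _ => claimedExistence_of_noBlowup hNB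

/-- **The claimed theorem IS «no blow-up on every closed slab» in the paper's own class** (existence by
patching, uniqueness a theorem of the tree). [cite: Magsanop2026, Thm 1 p.2 l.5–10; §3 p.3 l.101–103] -/
theorem claimedTheorem_iff_noBlowup : ClaimedTheorem ↔ NoBlowup :=
  ⟨fun h => noBlowup_of_claimedExistence h.1,
    fun h => claimedTheorem_of_existence (claimedExistence_of_noBlowup h)⟩

/-- **COMPOSITION on the §3 binders alone**: Lemma 2.2, Lemma 2.4, the two displays of p.3 l.71–75, the
assembly and BKM give the claimed theorem — the Strategy's `Step_T0` / `Step_smallData` / `Step_glue` and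
the word «unique» are theorems or idle. PROVED, pure logic over `claimedTheorem_iff_noBlowup`; nothing
asserted. [cite: Magsanop2026, §3 pp.2–4; Strategy p.2 l.11–13; §4 p.4 l.10–14] -/
theorem claim_of_steps'' (h22 : Step_L22) (h24 : Step_L24) (hGN : Step_GN) (hLV : Step_lapVort)
    (hA : Step_assembly) (hB : Step_BKM) : ClaimedTheorem :=
  claimedTheorem_iff_noBlowup.2 (hB (hA h22 h24 hGN hLV))

/-- `clay_of_steps` on the §3 binders alone. [cite: Magsanop2026, §4 p.4 l.13–14] [cite: FeffermanClay2006, (A) p.2] -/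
theorem clay_of_steps'' (h22 : Step_L22) (h24 : Step_L24) (hGN : Step_GN) (hLV : Step_lapVort)
    (hA : Step_assembly) (hB : Step_BKM) : clayR3.Regularity :=
  clay_of_claimed (claim_of_steps'' h22 h24 hGN hLV hA hB)

/-- From the printed inputs in print order, without the Strategy binders and «unique»: Thm 2 and Remark 1
drop out with `Step_T0`. [cite: Magsanop2026, §3 pp.2–3; (2) p.4 l.1–4] -/
theorem claim_of_printed_steps'' (hI : Step_L22_ineq) (hE : Step_energyId) (hGr : Step_L22_gronwall)
    (h24 : Step_L24) (hGN : Step_GN) (hLV : Step_lapVort) (hA : Step_assembly) (hB : Step_BKM) :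
    ClaimedTheorem :=
  claim_of_steps'' (stepL22_of_printed hI hE hGr) h24 hGN hLV hA hB

end Literature.Claims.NS.Magsanop2026

end

-- WHAT THIS IS NOT: not a claim about NS regularity or blow-up; not a claim about any author beyond the typed locator.
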